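import Summits.BirchSwinnertonDyer.BirchSwinnertonDyer.Theorems.ByReductionTypeAtTwoOrdKatoHalfAtTwoIsoSteinbergSahResidue
import Summits.BirchSwinnertonDyer.BirchSwinnertonDyer.Theorems.ByReductionTypeAtTwoOrdKatoHalfAtTwoIsoPortRealPlace
import Literature.NumberTheory.EllipticCurves.KummerImageIsotropy
import HarnessLib

/-!
# Route ByReductionTypeAtTwo, crux `OrdKatoHalfAtTwoIso` (stmt-BirchSwinnertonDyer-19573), line
# `steinberg-fibre-at-two` (skeleton v5): ENGINE of the registered stub Ω1 = (H-C) `ChebotarevTranspositionTwo` —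
# the transposition slot on `E[2]`, the pairing off the diagonal, Steinberg–Sah for the untwisted `E[2]`, and
# (F5) the `Γ`-stable subgroups of `E[2] × E[2]`

Seat `cruxlead-stmt-BirchSwinnertonDyer-19573-g0` (LEAD PROVER, MODE LINE; stub-worker for Ω1). HONEST FRAMING (cell
bsd-2adic): BSD is not proved by any of this; the crux `OrdKatoHalfAtTwoIso` is not proved here; this is the FIRST of two
files closing the registered stub Ω1 (`stub_HC_chebotarevTranspositionTwo : ChebotarevTranspositionTwo`, statement (H-C) of
`…OmegaRoadDefs.lean` §2, credit sidea-stub_port-2; route = stub-critic's STUB-PLAN F3/F5) of line steinberg-fibre-at-two;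
`--supports stmt-BirchSwinnertonDyer-19573 --as helper`. Theorems only; no definition, no named fact, no `sorry`.

* §1 decidable facts about `S₃` and the frame vectors `v₀, v₁, v₂ ∈ (ℤ/2)²`.
* §2 `exists_fixedPoint_of_sign_permGal_eq_neg_one` — a transposition `c` on `E[2] = {0, T₀, T₁, T₂}` has fixed line
  `ℓ = {0, P}` and `c x − x = P` off `ℓ`; `weilPairingHom_two_ne_zero_of_ne` — an alternating non-degenerate pairing
  is `≠ 1` on distinct non-zero points; `weilPairingHom_two_smul_sub_ne_zero` — hence `e((c−1)x, y) ≠ 1` for `x, y ∉ ℓ`.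
* §3 `torsion_two_oneCocycleClass_eq_zero_of_forall_mem_eq_zero_of_residue` — Steinberg–Sah on the residue
  (`ρ̄_{E,2}` onto, `Δ < 0`) for the UNTWISTED module `E[2]`: a cocycle vanishing on `ker ρ̄₂ ⊓ ker κ` has zero class
  (engine `SahRelNormal` p656928 with `H = ker(sgn ∘ permGal)` and the 3-cycle `σ₀ ∈ ker κ` of p658151; the
  untwisted companion of p657595).
* §4 (F5) `stableProd_eq_top_or_diagonal` — for `Γ` acting irreducibly on `V` with an element `c` whose fixed points
  are `{0, P}`, a diagonally stable `A ≤ V × V` with both projections non-zero is `V × V` or the diagonal;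
  `exists_mem_stableProd_smul_add_ne` — the choice of a joint value `(α, β) ∈ A` with `α + u`, `β + u'` off `ℓ_c`.

References: C.-H. Sah, J. Algebra 10 (1968) Prop. 2.7 (b) [Sah1968]; J.-P. Serre, Invent. Math. 15 (1972) §2.6 [Serre1972];
J. H. Silverman, *AEC* (2009) III.6.4, III.§7, III.8.1 [SilvermanAEC2009]; B. Mazur, K. Rubin, Mem. AMS 799 (2004) §3.6
[MazurRubin2004]; the line's helpers p656928, p657099, p657370, p657595, p658151.
-/

set_option autoImplicit false
set_option linter.dupNamespace false

noncomputable section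

open Field WeierstrassCurve Function
open Literature.NumberTheory.EllipticCurves Literature.NumberTheory.GaloisRepresentations
open Literature.NumberTheory.EllipticCurves.DokchitserDokchitser2012

-- D-0017: single-problem summit, so `Summit.BirchSwinnertonDyer.BirchSwinnertonDyer.…` repeats a namespace BY DESIGN.
namespace Summit.BirchSwinnertonDyer.BirchSwinnertonDyer.Theorems.SteinbergFibreAtTwo

/-! ## §1 Decidable facts about `S₃ = Perm (Fin 3)` and `(ℤ/2)²` -/

/-- An odd permutation of three letters (a transposition) has a fixed letter. [folklore] -/
theorem perm_fin_three_exists_apply_eq_of_sign_eq_neg_one :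
    ∀ g : Equiv.Perm (Fin 3), Equiv.Perm.sign g = -1 → ∃ i : Fin 3, g i = i := by
  decide

/-- An odd permutation of three letters has exactly one fixed letter. [folklore] -/
theorem perm_fin_three_apply_eq_unique_of_sign_eq_neg_one :
    ∀ g : Equiv.Perm (Fin 3), Equiv.Perm.sign g = -1 → ∀ i j : Fin 3, g i = i → g j = j → j = i := by
  decide

/-- For a transposition `g` of three letters fixing `i` and moving `j`: `v_{g j} + v_j = v_i` in `(ℤ/2)²`
(`v₀ + v₁ + v₂ = 0`). [folklore] -/
theorem perm_fin_three_vec_add_of_sign_eq_neg_one :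
    ∀ g : Equiv.Perm (Fin 3), Equiv.Perm.sign g = -1 → ∀ i j : Fin 3, g i = i → g j ≠ j →
      vec (g j) + vec j = vec i := by
  decide

/-- Three letters: a third letter `k ∉ {i, j}` has `v_k = v_i + v_j` in `(ℤ/2)²` (`v₀ + v₁ + v₂ = 0`). [folklore] -/
theorem fin_three_eq_or_eq_or_vec_eq_add :
    ∀ i j k : Fin 3, i ≠ j → k = i ∨ k = j ∨ vec k = vec i + vec j := by
  decide

/-! ## §2 `E[2]`: the fixed line of a transposition, and the pairing off the diagonal -/

section Slot

variable (W : WeierstrassCurve ℚ) [W.IsElliptic]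

/-- **The fixed line `ℓ = {0, P}` of a transposition on `E[2]` and `(c − 1)x = P` off `ℓ`.** For `c ∈ Γ_ℚ` inducing an
odd permutation of `{T₀, T₁, T₂}`: there is `P ≠ 0` with `c P = P`, every `c`-fixed point is `0` or `P`, and
`c x − x = P` whenever `c x ≠ x` (`c T_j − T_j = T_{c j} + T_j = T_i`). [cite: SilvermanAEC2009, Cor. III.6.4(b)] -/
theorem exists_fixedPoint_of_sign_permGal_eq_neg_one {c : absoluteGaloisGroup ℚ}
    (hc : Equiv.Perm.sign (permGal W two_ne_zero c) = -1) :
    ∃ P : geomTorsion W 2, P ≠ 0 ∧ c • P = P ∧ (∀ x : geomTorsion W 2, c • x = x → x = 0 ∨ x = P) ∧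
      ∀ x : geomTorsion W 2, c • x ≠ x → c • x - x = P := by
  obtain ⟨i, hi⟩ := perm_fin_three_exists_apply_eq_of_sign_eq_neg_one _ hc
  refine ⟨T W two_ne_zero i, fun h => coe_T_ne_zero W two_ne_zero i (by rw [h]; rfl),
    by rw [← T_permGal, hi], fun x hx => ?_, fun x hx => ?_⟩
  · rcases eq_zero_or_eq_T W two_ne_zero x with rfl | ⟨j, rfl⟩
    · exact Or.inl rfl
    · right
      rw [← T_permGal] at hx
      rw [perm_fin_three_apply_eq_unique_of_sign_eq_neg_one _ hc i j hi (T_injective W two_ne_zero hx)]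
  · rcases eq_zero_or_eq_T W two_ne_zero x with rfl | ⟨j, rfl⟩
    · exact absurd (smul_zero c) hx
    · have hj : permGal W two_ne_zero c j ≠ j := fun h => hx (by rw [← T_permGal, h])
      rw [← T_permGal, sub_eq_add_neg, neg_eq_self_geomTorsion_two]
      apply (frame W two_ne_zero).injective
      rw [map_add, frame_T_eq_vec, frame_T_eq_vec, frame_T_eq_vec]
      exact perm_fin_three_vec_add_of_sign_eq_neg_one _ hc i j hi hj

variable (eW : geomTorsion W (2 : ℤ) → geomTorsion W (2 : ℤ) → AlgebraicClosure ℚ)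
  (hμ : ∀ S T, eW S T ^ 2 = 1)
  (hadd₁ : ∀ S₁ S₂ T, eW (S₁ + S₂) T = eW S₁ T * eW S₂ T)
  (hadd₂ : ∀ S T₁ T₂, eW S (T₁ + T₂) = eW S T₁ * eW S T₂)

/-- **An alternating non-degenerate pairing on `E[2] ≅ (ℤ/2)²` is non-zero off the diagonal**: `e(x, y) ≠ 1` for
`x ≠ 0`, `y ≠ 0`, `x ≠ y` (otherwise `e(·, y)` vanishes on `{0, x, y, x + y} = E[2]`). [cite: SilvermanAEC2009, Prop. III.8.1(a),(c)] -/
theorem weilPairingHom_two_ne_zero_of_ne (halt : ∀ T, eW T T = 1) (hnondeg : ∀ T, (∀ S, eW S T = 1) → T = 0)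
    {x y : geomTorsion W 2} (hx : x ≠ 0) (hy : y ≠ 0) (hxy : x ≠ y) :
    weilPairingHom W 2 eW hμ hadd₁ hadd₂ x y ≠ 0 := by
  intro h
  refine hy (hnondeg y fun s => ?_)
  -- every `s` is one of `0, x, y, x + y` (`E[2] = {0, T₀, T₁, T₂}`, `T₀ + T₁ + T₂ = 0`)
  have hs : s = 0 ∨ s = x ∨ s = y ∨ s = x + y := by
    rcases eq_zero_or_eq_T W two_ne_zero x with rfl | ⟨i, rfl⟩
    · exact absurd rfl hx
    rcases eq_zero_or_eq_T W two_ne_zero y with rfl | ⟨j, rfl⟩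
    · exact absurd rfl hy
    have hij : i ≠ j := fun h => hxy (by rw [h])
    rcases eq_zero_or_eq_T W two_ne_zero s with rfl | ⟨k, rfl⟩
    · exact Or.inl rfl
    rcases fin_three_eq_or_eq_or_vec_eq_add i j k hij with rfl | rfl | hk
    · exact Or.inr (Or.inl rfl)
    · exact Or.inr (Or.inr (Or.inl rfl))
    · refine Or.inr (Or.inr (Or.inr ((frame W two_ne_zero).injective ?_)))
      rw [map_add, frame_T_eq_vec, frame_T_eq_vec, frame_T_eq_vec]
      exact hk
  -- and `e(·, y)` vanishes at each of them
  have hval : weilPairingHom W 2 eW hμ hadd₁ hadd₂ s y = 0 := by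
    rcases hs with rfl | rfl | rfl | rfl
    · rw [map_zero, AddMonoidHom.zero_apply]
    · exact h
    · exact weilPairingHom_self W 2 eW hμ hadd₁ hadd₂ halt _
    · rw [map_add, AddMonoidHom.add_apply, h, weilPairingHom_self W 2 eW hμ hadd₁ hadd₂ halt, add_zero]
  have hval' := muCarrier_eq_iff.mp hval
  rw [coe_weilPairingHom] at hval'
  exact hval'

/-- **`e((c − 1)x, y) ≠ 1` off the fixed line of a transposition.** For `c` odd on `{T₀, T₁, T₂}` and `x, y ∉ ℓ_c`:
`(c−1)x = P ≠ 0`, `y ∉ {0, P}`, so `e(P, y) ≠ 1`. [cite: SilvermanAEC2009, Prop. III.8.1(a),(c)] -/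
theorem weilPairingHom_two_smul_sub_ne_zero (halt : ∀ T, eW T T = 1)
    (hnondeg : ∀ T, (∀ S, eW S T = 1) → T = 0) {c : absoluteGaloisGroup ℚ}
    (hc : Equiv.Perm.sign (permGal W two_ne_zero c) = -1) {x y : geomTorsion W 2} (hx : c • x ≠ x)
    (hy : c • y ≠ y) : weilPairingHom W 2 eW hμ hadd₁ hadd₂ (c • x - x) y ≠ 0 := by
  obtain ⟨P, hP0, hcP, hℓ, hmove⟩ := exists_fixedPoint_of_sign_permGal_eq_neg_one W hc
  rw [hmove x hx]
  refine weilPairingHom_two_ne_zero_of_ne W eW hμ hadd₁ hadd₂ halt hnondeg hP0 (fun h => hy ?_) fun h => hy ?_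
  · rw [h, smul_zero]
  · rw [← h, hcP]

end Slot

/-! ## §3 Steinberg–Sah on the residue for the UNTWISTED module `E[2]` -/

section Sah

variable (W : WeierstrassCurve ℚ) [W.IsElliptic] (κ : ZpExtension ℚ 2)

/-- **Steinberg–Sah for `E[2]` itself on the residue, vanishing form**: for `ρ̄_{E,2}` onto and `Δ < 0`, a continuous
1-cocycle of `Γ_ℚ` in `E[2]` vanishing on `ker ρ̄_{E,2} ⊓ ker κ` has zero class. (The engine `SahRelNormal` with
`H = ker(sgn ∘ permGal)`, `z = σ₀` a 3-cycle in `ker κ` — the untwisted companion of p657595.)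
[cite: Sah1968, Prop. 2.7 (b) and its proof, p. 60] [cite: Serre1972, §2.6] -/
theorem torsion_two_oneCocycleClass_eq_zero_of_forall_mem_eq_zero_of_residue
    (h2 : W.HasSurjectiveModNGaloisRep 2) (hΔ : W.Δ < 0)
    (δ : contOneCocycles (W.torsionGaloisModule (2 : ℤ)).toTopRep)
    (hN : ∀ ν ∈ (galoisRepTorsion W 2).ker ⊓ κ.kerSubgroup, δ.1 ν = 0) :
    oneCocycleClass _ δ = 0 := by
  obtain ⟨σ₀, hκ, hσ₀⟩ := exists_mem_kerSubgroup_noFixedPoint_of_residue W κ h2 hΔ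
  have h2Q : (2 : ℚ) ≠ 0 := two_ne_zero
  -- `H = ker (sgn ∘ permGal)`, a normal subgroup containing `N` and the 3-cycle `σ₀`
  let πG : absoluteGaloisGroup ℚ →* Equiv.Perm (Fin 3) :=
    { toFun := permGal W h2Q, map_one' := permGal_one W h2Q, map_mul' := permGal_mul W h2Q }
  let H : Subgroup (absoluteGaloisGroup ℚ) := (Equiv.Perm.sign.comp πG).ker
  have hHmem : ∀ g, g ∈ H ↔ Equiv.Perm.sign (permGal W h2Q g) = 1 := fun g => by
    change (Equiv.Perm.sign.comp πG) g = 1 ↔ _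
    rfl
  have hHnormal : H.Normal := MonoidHom.normal_ker _
  have hσ₀T : ∀ i, permGal W h2Q σ₀ i ≠ i := by
    intro i hi
    have hT : σ₀ • T W h2Q i = T W h2Q i := by rw [← T_permGal, hi]
    exact hσ₀ (T W h2Q i) (fun h0 => coe_T_ne_zero W h2Q i (by rw [h0]; rfl)) hT
  have hσ₀H : σ₀ ∈ H := (hHmem σ₀).mpr (perm_fin_three_sign_eq_one_of_forall_ne _ hσ₀T)
  have hNH : (galoisRepTorsion W 2).ker ⊓ κ.kerSubgroup ≤ H := by
    intro ν hν
    have hν1 : permGal W h2Q ν = 1 :=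
      (forall_smul_eq_iff_permGal_eq_one W ν).mp
        ((mem_ker_galoisRepTorsion_two_iff W ν).mp (Subgroup.mem_inf.mp hν).1)
    rw [hHmem, hν1, map_one]
  -- `σ₀` commutes with `H` on `E[2]`, hence is central in `H` modulo `N`
  have hcommE : ∀ h ∈ H, ∀ P : geomTorsion W 2, σ₀ • h • P = h • σ₀ • P := by
    intro h hh P
    have hperm : permGal W h2Q (σ₀ * h) = permGal W h2Q (h * σ₀) := by
      rw [permGal_mul, permGal_mul]
      exact perm_fin_three_comm_of_sign_eq_one _ _ ((hHmem σ₀).mp hσ₀H) ((hHmem h).mp hh)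
    rw [← mul_smul, ← mul_smul]
    exact smul_eq_smul_of_permGal_eq W hperm P
  have hz : ∀ h ∈ H, ∃ n ∈ (galoisRepTorsion W 2).ker ⊓ κ.kerSubgroup, σ₀ * h = h * σ₀ * n := by
    intro h hh
    refine ⟨(h * σ₀)⁻¹ * (σ₀ * h), Subgroup.mem_inf.mpr ⟨?_, ?_⟩, by group⟩
    · rw [mem_ker_galoisRepTorsion_two_iff]
      intro P
      rw [mul_smul, mul_smul, hcommE h hh P, ← mul_smul h σ₀, inv_smul_smul]
    · rw [ZpExtension.mem_kerSubgroup] at hκ ⊢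
      rw [map_mul, map_inv, map_mul, map_mul, hκ, mul_one, one_mul, inv_mul_cancel]
  have hcomm : ∀ h ∈ H, ∀ x : (W.torsionGaloisModule (2 : ℤ)).toTopRep,
      (W.torsionGaloisModule (2 : ℤ)).toTopRep.ρ σ₀ ((W.torsionGaloisModule (2 : ℤ)).toTopRep.ρ h x) =
        (W.torsionGaloisModule (2 : ℤ)).toTopRep.ρ h ((W.torsionGaloisModule (2 : ℤ)).toTopRep.ρ σ₀ x) :=
    fun h hh x => hcommE h hh x
  -- `σ₀ − 1` is bijective on the finite `E[2]` (no non-zero fixed point)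
  haveI : Finite (geomTorsion W (2 : ℤ)) :=
    WeierstrassCurve.finite_torsionPoints_holds W (AlgebraicClosure ℚ) (by norm_num)
  have hbij : Bijective fun x : (W.torsionGaloisModule (2 : ℤ)).toTopRep =>
      (W.torsionGaloisModule (2 : ℤ)).toTopRep.ρ σ₀ x - x := by
    have hinj : Injective fun x : geomTorsion W (2 : ℤ) => σ₀ • x - x := by
      intro x y hxy
      by_contra hne
      refine hσ₀ (x - y) (sub_ne_zero.mpr hne) ?_
      rw [smul_sub]
      exact sub_eq_sub_iff_sub_eq_sub.mp hxy
    exact ⟨hinj, Finite.injective_iff_surjective.mp hinj⟩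
  exact SahRelNormal.oneCocycleClass_eq_zero_of_forall_mem_eq_zero_of_normal δ _ H hHnormal hNH hN hσ₀H hz
    hcomm hbij

end Sah

/-! ## §4 (F5) `Γ`-stable subgroups of `V × V` with both projections non-zero, `V` irreducible with a
transposition: everything or the diagonal; the choice of the joint value -/

section StableProd

variable {Γ V : Type*} [Group Γ] [AddCommGroup V] [DistribMulAction Γ V]

/-- **(F5) Stable subgroups of `V × V`.** Let `Γ` act on `V` irreducibly (every stable additive subgroup is `⊥` or
`⊤`), let `c ∈ Γ` have fixed points exactly `{0, P}` with `P ≠ 0`, and let `A ≤ V × V` be a diagonally `Γ`-stable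
additive subgroup with both projections non-zero. Then `A = V × V`, or `A` is the diagonal. (If `{β | (0,β) ∈ A}` or
`{α | (α,0) ∈ A}` is everything, `A = ⊤`; otherwise both vanish, `(P, β) ∈ A` forces `cβ = β`, `β ∈ {0, P}`, `β = P`,
and the stable subgroup `{x | (x,x) ∈ A} ∋ P` is everything.) [folklore] -/
theorem stableProd_eq_top_or_diagonal
    (hirr : ∀ B : AddSubgroup V, (∀ g : Γ, ∀ x ∈ B, g • x ∈ B) → B = ⊥ ∨ B = ⊤)
    {c : Γ} {P : V} (hP0 : P ≠ 0) (hcP : c • P = P) (hℓ : ∀ x : V, c • x = x → x = 0 ∨ x = P)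
    (A : AddSubgroup (V × V)) (hA : ∀ g : Γ, ∀ z ∈ A, (g • z.1, g • z.2) ∈ A)
    (h1 : ∃ z ∈ A, z.1 ≠ 0) (h2 : ∃ z ∈ A, z.2 ≠ 0) :
    A = ⊤ ∨ ((∀ z ∈ A, z.1 = z.2) ∧ ∀ x : V, (x, x) ∈ A) := by
  -- both projections are everything
  have hst1 : ∀ g : Γ, ∀ x ∈ A.map (AddMonoidHom.fst V V), g • x ∈ A.map (AddMonoidHom.fst V V) := by
    intro g x hx
    obtain ⟨z, hz, rfl⟩ := AddSubgroup.mem_map.mp hx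
    exact AddSubgroup.mem_map.mpr ⟨(g • z.1, g • z.2), hA g z hz, rfl⟩
  have hst2 : ∀ g : Γ, ∀ x ∈ A.map (AddMonoidHom.snd V V), g • x ∈ A.map (AddMonoidHom.snd V V) := by
    intro g x hx
    obtain ⟨z, hz, rfl⟩ := AddSubgroup.mem_map.mp hx
    exact AddSubgroup.mem_map.mpr ⟨(g • z.1, g • z.2), hA g z hz, rfl⟩
  have hpr1 : ∀ x : V, ∃ z ∈ A, z.1 = x := by
    rcases hirr _ hst1 with h | h
    · obtain ⟨z, hz, hz0⟩ := h1
      exact absurd ((AddSubgroup.eq_bot_iff_forall _).mp h z.1 (AddSubgroup.mem_map.mpr ⟨z, hz, rfl⟩)) hz0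
    · intro x
      obtain ⟨z, hz, hzx⟩ := AddSubgroup.mem_map.mp ((AddSubgroup.eq_top_iff' _).mp h x)
      exact ⟨z, hz, hzx⟩
  have hpr2 : ∀ y : V, ∃ z ∈ A, z.2 = y := by
    rcases hirr _ hst2 with h | h
    · obtain ⟨z, hz, hz0⟩ := h2
      exact absurd ((AddSubgroup.eq_bot_iff_forall _).mp h z.2 (AddSubgroup.mem_map.mpr ⟨z, hz, rfl⟩)) hz0
    · intro y
      obtain ⟨z, hz, hzy⟩ := AddSubgroup.mem_map.mp ((AddSubgroup.eq_top_iff' _).mp h y)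
      exact ⟨z, hz, hzy⟩
  -- the fibres `B = {β | (0, β) ∈ A}`, `B' = {α | (α, 0) ∈ A}` are stable
  have hstB : ∀ g : Γ, ∀ y ∈ A.comap (AddMonoidHom.inr V V), g • y ∈ A.comap (AddMonoidHom.inr V V) := by
    intro g y hy
    rw [AddSubgroup.mem_comap, AddMonoidHom.inr_apply] at hy ⊢
    simpa only [smul_zero] using hA g _ hy
  have hstB' : ∀ g : Γ, ∀ x ∈ A.comap (AddMonoidHom.inl V V), g • x ∈ A.comap (AddMonoidHom.inl V V) := by
    intro g x hx
    rw [AddSubgroup.mem_comap, AddMonoidHom.inl_apply] at hx ⊢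
    simpa only [smul_zero] using hA g _ hx
  rcases hirr _ hstB with hB | hB
  swap
  · -- `B = V`: `A = V × V`
    left
    refine (AddSubgroup.eq_top_iff' _).mpr fun z => ?_
    obtain ⟨z', hz', hz'1⟩ := hpr1 z.1
    have hy : (0, z.2 - z'.2) ∈ A := by
      have := (AddSubgroup.eq_top_iff' _).mp hB (z.2 - z'.2)
      rwa [AddSubgroup.mem_comap, AddMonoidHom.inr_apply] at this
    have hsum := A.add_mem hz' hy
    have heq : z' + (0, z.2 - z'.2) = z := by
      ext
      · simp [hz'1]
      · simp
    rw [heq] at hsum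
    exact hsum
  rcases hirr _ hstB' with hB' | hB'
  swap
  · -- `B' = V`: `A = V × V`
    left
    refine (AddSubgroup.eq_top_iff' _).mpr fun z => ?_
    obtain ⟨z', hz', hz'2⟩ := hpr2 z.2
    have hx : (z.1 - z'.1, 0) ∈ A := by
      have := (AddSubgroup.eq_top_iff' _).mp hB' (z.1 - z'.1)
      rwa [AddSubgroup.mem_comap, AddMonoidHom.inl_apply] at this
    have hsum := A.add_mem hz' hx
    have heq : z' + (z.1 - z'.1, 0) = z := by
      ext
      · simp
      · simp [hz'2]
    rw [heq] at hsum
    exact hsum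
  -- `B = B' = 0`: `A` is the diagonal
  right
  have huniq : ∀ x y y' : V, (x, y) ∈ A → (x, y') ∈ A → y = y' := by
    intro x y y' h h'
    have hd : (0, y - y') ∈ A := by
      have := A.sub_mem h h'
      rwa [Prod.mk_sub_mk, sub_self] at this
    have hd' : y - y' ∈ A.comap (AddMonoidHom.inr V V) := by
      rw [AddSubgroup.mem_comap, AddMonoidHom.inr_apply]
      exact hd
    rw [hB] at hd'
    exact sub_eq_zero.mp (AddSubgroup.mem_bot.mp hd')
  have hPP : (P, P) ∈ A := by
    obtain ⟨z, hz, hz1⟩ := hpr1 P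
    have hzP : (P, z.2) ∈ A := by
      rw [← hz1, Prod.mk.eta]
      exact hz
    have hcz : (P, c • z.2) ∈ A := by simpa only [hcP] using hA c _ hzP
    rcases hℓ _ (huniq P _ _ hcz hzP) with h0 | hP'
    · exfalso
      apply hP0
      have hP' : P ∈ A.comap (AddMonoidHom.inl V V) := by
        rw [AddSubgroup.mem_comap, AddMonoidHom.inl_apply, ← h0]
        exact hzP
      rw [hB'] at hP'
      exact AddSubgroup.mem_bot.mp hP'
    · rw [hP'] at hzP
      exact hzP
  have hstD : ∀ g : Γ, ∀ x ∈ A.comap ((AddMonoidHom.id V).prod (AddMonoidHom.id V)),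
      g • x ∈ A.comap ((AddMonoidHom.id V).prod (AddMonoidHom.id V)) := by
    intro g x hx
    rw [AddSubgroup.mem_comap, AddMonoidHom.prod_apply, AddMonoidHom.id_apply] at hx ⊢
    exact hA g _ hx
  have hD : ∀ x : V, (x, x) ∈ A := by
    rcases hirr _ hstD with h | h
    · exfalso
      have hP' : P ∈ A.comap ((AddMonoidHom.id V).prod (AddMonoidHom.id V)) := by
        rw [AddSubgroup.mem_comap, AddMonoidHom.prod_apply, AddMonoidHom.id_apply]
        exact hPP
      rw [h] at hP'
      exact hP0 (AddSubgroup.mem_bot.mp hP')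
    · intro x
      have hx := (AddSubgroup.eq_top_iff' _).mp h x
      rw [AddSubgroup.mem_comap, AddMonoidHom.prod_apply, AddMonoidHom.id_apply] at hx
      exact hx
  refine ⟨fun z hz => (huniq z.1 z.2 z.1 ?_ (hD z.1)).symm, hD⟩
  rw [Prod.mk.eta]
  exact hz

/-- **The choice of the joint value.** In the situation of `stableProd_eq_top_or_diagonal`, given `u u' : V` such
that `u − u'` is `c`-fixed whenever `A` is the diagonal, and some `x₀` moved by `c`: some `(α, β) ∈ A` has both
`α + u` and `β + u'` moved by `c` (`A = ⊤`: `α = x₀ − u`, `β = x₀ − u'`; diagonal: `α = β = x₀ − u`). [folklore] -/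
theorem exists_mem_stableProd_smul_add_ne
    (hirr : ∀ B : AddSubgroup V, (∀ g : Γ, ∀ x ∈ B, g • x ∈ B) → B = ⊥ ∨ B = ⊤)
    {c : Γ} {P : V} (hP0 : P ≠ 0) (hcP : c • P = P) (hℓ : ∀ x : V, c • x = x → x = 0 ∨ x = P)
    (A : AddSubgroup (V × V)) (hA : ∀ g : Γ, ∀ z ∈ A, (g • z.1, g • z.2) ∈ A)
    (h1 : ∃ z ∈ A, z.1 ≠ 0) (h2 : ∃ z ∈ A, z.2 ≠ 0) (u u' : V)
    (hdiag : (∀ z ∈ A, z.1 = z.2) → c • (u - u') = u - u') {x₀ : V} (hx₀ : c • x₀ ≠ x₀) :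
    ∃ z ∈ A, c • (z.1 + u) ≠ z.1 + u ∧ c • (z.2 + u') ≠ z.2 + u' := by
  rcases stableProd_eq_top_or_diagonal hirr hP0 hcP hℓ A hA h1 h2 with htop | ⟨hdg, hall⟩
  · refine ⟨(x₀ - u, x₀ - u'), (AddSubgroup.eq_top_iff' _).mp htop _, ?_, ?_⟩
    · dsimp only
      rw [sub_add_cancel]
      exact hx₀
    · dsimp only
      rw [sub_add_cancel]
      exact hx₀
  · refine ⟨(x₀ - u, x₀ - u), hall _, ?_, ?_⟩
    · dsimp only
      rw [sub_add_cancel]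
      exact hx₀
    · dsimp only
      have hrw : x₀ - u + u' = x₀ - (u - u') := by abel
      rw [hrw, smul_sub, hdiag hdg]
      intro h
      exact hx₀ (sub_left_inj.mp h)

end StableProd

end Summit.BirchSwinnertonDyer.BirchSwinnertonDyer.Theorems.SteinbergFibreAtTwo

end
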